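import Literature.MathematicalPhysics.QuantumFieldTheory.OSTemperednessPieces
import Literature.Analysis.Complex.BochnerArgRegion
import HarnessLib

/-!
# Polynomial bookkeeping for the explicit bound of the Schwinger density (OS II Thm. 4.1 (4.5))

Topic `Literature/MathematicalPhysics/QuantumFieldTheory`; support file for the temperedness
estimate (4.5) of Osterwalder–Schrader II, Thm. 4.1. The explicit bound `qsF Cv M x` of
`OSTemperednessPieces.schwinger_density_centre_le` is a closed-form function of `‖x‖` and of the
minimal time gap `minGap x`; this file shows that it is **dominated by a polynomial in `1 + ‖x‖`
and `1 + (minGap x)⁻¹`** (`polyDom_qsF`), by a small calculus of polynomially dominated functions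
on the ordered region (`PolyDom`: constants, `1 + ‖x‖`, `(minGap x)⁻¹`, `minGap x`, sums, products,
powers, maxima, and the one transcendental input `e^{Λ(x)} ≤ poly` through
`e^{|log u|} ≤ u + u⁻¹`, `Literature.Analysis.Complex.exp_abs_log_le`).

## References

* K. Osterwalder, R. Schrader, *Axioms for Euclidean Green's functions II*, Comm. Math. Phys.
  42 (1975) 281–305, Thm. 4.1 (4.5), Ch. VI.1 (6.12)–(6.14). [OsterwalderSchraderCMP1975]
-/

noncomputable section

open MeasureTheory Set Filter Module Metric Real
open _root_.Topology
open scoped InnerProductSpace RealInnerProductSpace SchwartzMap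

namespace Literature.MathematicalPhysics.QuantumFieldTheory

open Literature.MathematicalPhysics.QuantumLattice (schwartzNorm)
open Literature.Analysis.Distribution
open Literature.Analysis.Complex
open OSFrames

variable {d : ℕ} [NeZero d] {k : ℕ}

/-! ### Polynomially dominated functions on the ordered region -/

/-- **Polynomial domination on the ordered region**: `|f x| ≤ C (1 + ‖x‖)ᴺ (1 + (minGap x)⁻¹)ᴺ`. [folklore] -/
def PolyDom (k d : ℕ) [NeZero d] (f : (Fin (k + 2) → EuclideanSpace ℝ (Fin d)) → ℝ) : Prop :=
  ∃ C : ℝ, ∃ N : ℕ, 0 ≤ C ∧ ∀ x ∈ orderedRegion k d, |f x| ≤ C * (1 + ‖x‖) ^ N * (1 + (minGap x)⁻¹) ^ N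

namespace PolyDom

variable {f g : (Fin (k + 2) → EuclideanSpace ℝ (Fin d)) → ℝ}

omit [NeZero d] in
/-- The weights are at least one. [folklore] -/
theorem one_le_weight [NeZero d] {x : Fin (k + 2) → EuclideanSpace ℝ (Fin d)} (hx : x ∈ orderedRegion k d) (N : ℕ) :
    1 ≤ (1 + ‖x‖) ^ N * (1 + (minGap x)⁻¹) ^ N :=
  one_le_mul_of_one_le_of_one_le (one_le_pow₀ (by simp))
    (one_le_pow₀ (by have := minGap_pos hx; simp [this.le]))

/-- Enlarging the exponent. [folklore] -/
theorem weight_mono {x : Fin (k + 2) → EuclideanSpace ℝ (Fin d)} (hx : x ∈ orderedRegion k d) {N N' : ℕ} (h : N ≤ N') :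
    (1 + ‖x‖) ^ N * (1 + (minGap x)⁻¹) ^ N ≤ (1 + ‖x‖) ^ N' * (1 + (minGap x)⁻¹) ^ N' := by
  have h1 : (1 : ℝ) ≤ 1 + ‖x‖ := by simp
  have h2 : (1 : ℝ) ≤ 1 + (minGap x)⁻¹ := by have := minGap_pos hx; simp [this.le]
  exact mul_le_mul (pow_le_pow_right₀ h1 h) (pow_le_pow_right₀ h2 h) (by positivity) (by positivity)

/-- Constants. [folklore] -/
theorem const (c : ℝ) : PolyDom k d fun _ => c :=
  ⟨|c|, 0, abs_nonneg c, fun _ _ => by simp⟩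

/-- Domination by a dominated function. [folklore] -/
theorem of_abs_le (hg : PolyDom k d g) (h : ∀ x ∈ orderedRegion k d, |f x| ≤ g x) : PolyDom k d f := by
  obtain ⟨C, N, hC, hg⟩ := hg
  exact ⟨C, N, hC, fun x hx => (h x hx).trans ((le_abs_self _).trans (hg x hx))⟩

/-- Sums. [folklore] -/
theorem add (hf : PolyDom k d f) (hg : PolyDom k d g) : PolyDom k d fun x => f x + g x := by
  obtain ⟨C₁, N₁, hC₁, hf⟩ := hf
  obtain ⟨C₂, N₂, hC₂, hg⟩ := hg
  refine ⟨C₁ + C₂, N₁ + N₂, by positivity, fun x hx => (abs_add_le _ _).trans ?_⟩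
  have h1 : |f x| ≤ C₁ * ((1 + ‖x‖) ^ (N₁ + N₂) * (1 + (minGap x)⁻¹) ^ (N₁ + N₂)) := by
    refine (hf x hx).trans ?_
    rw [mul_assoc]
    exact mul_le_mul_of_nonneg_left (weight_mono hx (Nat.le_add_right N₁ N₂)) hC₁
  have h2 : |g x| ≤ C₂ * ((1 + ‖x‖) ^ (N₁ + N₂) * (1 + (minGap x)⁻¹) ^ (N₁ + N₂)) := by
    refine (hg x hx).trans ?_
    rw [mul_assoc]
    exact mul_le_mul_of_nonneg_left (weight_mono hx (Nat.le_add_left N₂ N₁)) hC₂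
  calc |f x| + |g x| ≤ C₁ * ((1 + ‖x‖) ^ (N₁ + N₂) * (1 + (minGap x)⁻¹) ^ (N₁ + N₂)) +
        C₂ * ((1 + ‖x‖) ^ (N₁ + N₂) * (1 + (minGap x)⁻¹) ^ (N₁ + N₂)) := add_le_add h1 h2
    _ = (C₁ + C₂) * (1 + ‖x‖) ^ (N₁ + N₂) * (1 + (minGap x)⁻¹) ^ (N₁ + N₂) := by ring

/-- Products. [folklore] -/
theorem mul (hf : PolyDom k d f) (hg : PolyDom k d g) : PolyDom k d fun x => f x * g x := by
  obtain ⟨C₁, N₁, hC₁, hf⟩ := hf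
  obtain ⟨C₂, N₂, hC₂, hg⟩ := hg
  refine ⟨C₁ * C₂, N₁ + N₂, by positivity, fun x hx => ?_⟩
  rw [abs_mul]
  calc |f x| * |g x| ≤ (C₁ * (1 + ‖x‖) ^ N₁ * (1 + (minGap x)⁻¹) ^ N₁) * (C₂ * (1 + ‖x‖) ^ N₂ * (1 + (minGap x)⁻¹) ^ N₂) :=
        mul_le_mul (hf x hx) (hg x hx) (abs_nonneg _) (by have := minGap_pos hx; positivity)
    _ = C₁ * C₂ * (1 + ‖x‖) ^ (N₁ + N₂) * (1 + (minGap x)⁻¹) ^ (N₁ + N₂) := by rw [pow_add, pow_add]; ring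

/-- Powers. [folklore] -/
theorem pow (hf : PolyDom k d f) (n : ℕ) : PolyDom k d fun x => f x ^ n := by
  induction n with
  | zero => simpa using const (k := k) (d := d) 1
  | succ n ih => simpa [pow_succ] using ih.mul hf

/-- Agreement on the ordered region. [folklore] -/
theorem congr (hg : PolyDom k d g) (h : ∀ x ∈ orderedRegion k d, f x = g x) : PolyDom k d f := by
  obtain ⟨C, N, hC, hg⟩ := hg
  exact ⟨C, N, hC, fun x hx => by rw [h x hx]; exact hg x hx⟩

/-- Absolute values. [folklore] -/
theorem abs (hf : PolyDom k d f) : PolyDom k d fun x => |f x| := by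
  obtain ⟨C, N, hC, hf⟩ := hf
  exact ⟨C, N, hC, fun x hx => by rw [abs_abs]; exact hf x hx⟩

/-- Finite sums. [folklore] -/
theorem sum {ι : Type*} (s : Finset ι) {F : ι → (Fin (k + 2) → EuclideanSpace ℝ (Fin d)) → ℝ}
    (hF : ∀ i ∈ s, PolyDom k d (F i)) : PolyDom k d fun x => ∑ i ∈ s, F i x := by
  classical
  induction s using Finset.induction_on with
  | empty => simpa using const (k := k) (d := d) 0
  | @insert a s ha ih =>
    have h := (hF a (Finset.mem_insert_self a s)).add (ih fun i hi => hF i (Finset.mem_insert_of_mem hi))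
    exact h.congr fun x _ => by rw [Finset.sum_insert ha]

/-- Maxima. [folklore] -/
theorem max (hf : PolyDom k d f) (hg : PolyDom k d g) : PolyDom k d fun x => max (f x) (g x) :=
  (hf.abs.add hg.abs).of_abs_le fun _ _ =>
    (abs_max_le_max_abs_abs).trans (max_le (le_add_of_nonneg_right (abs_nonneg _)) (le_add_of_nonneg_left (abs_nonneg _)))

/-- Inverses of functions bounded below by a dominated reciprocal: if `0 < f` and `1/f ≤ g` with `g`
dominated then `f⁻¹` is dominated. (Convenience form: `|f⁻¹| ≤ g`.) [folklore] -/
theorem inv_of_le (hg : PolyDom k d g) (h : ∀ x ∈ orderedRegion k d, 0 < f x ∧ (f x)⁻¹ ≤ g x) :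
    PolyDom k d fun x => (f x)⁻¹ :=
  hg.of_abs_le fun x hx => by rw [abs_of_pos (inv_pos.2 (h x hx).1)]; exact (h x hx).2

/-- The size `1 + ‖x‖`. [folklore] -/
theorem one_add_norm : PolyDom k d fun x => 1 + ‖x‖ :=
  ⟨1, 1, zero_le_one, fun x hx => by
    rw [abs_of_pos (by positivity), pow_one, pow_one, one_mul]
    exact le_mul_of_one_le_right (by positivity) (by have := minGap_pos hx; simp [this.le])⟩

/-- The norm `‖x‖`. [folklore] -/
theorem norm : PolyDom k d fun x => ‖x‖ :=
  one_add_norm.of_abs_le fun x _ => by rw [abs_of_nonneg (norm_nonneg _)]; linarith [norm_nonneg x]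

/-- The inverse gap `(minGap x)⁻¹`. [folklore] -/
theorem inv_minGap : PolyDom k d fun x => (minGap x)⁻¹ :=
  ⟨1, 1, zero_le_one, fun x hx => by
    have h := minGap_pos hx
    rw [abs_of_pos (inv_pos.2 h), pow_one, pow_one, one_mul]
    calc (minGap x)⁻¹ ≤ 1 + (minGap x)⁻¹ := by linarith
      _ ≤ (1 + ‖x‖) * (1 + (minGap x)⁻¹) := le_mul_of_one_le_left (by positivity) (by simp)⟩

/-- The gap `minGap x ≤ 2‖x‖`. [folklore] -/
theorem minGap' : PolyDom k d fun x => minGap x :=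
  (norm.mul (const 2)).of_abs_le fun x hx => by
    rw [abs_of_pos (minGap_pos hx)]; linarith [minGap_le_two_mul_norm x]

end PolyDom

/-! ### The elementary pieces -/

open PolyDom

/-- `ε⁻¹ = 16 (2‖x‖ + 1) / minGap`. [folklore] -/
theorem polyDom_inv_qsEps : PolyDom k d fun x => (qsEps x)⁻¹ := by
  refine (((const 16).mul ((norm.mul (const 2)).add (const 1))).mul inv_minGap).of_abs_le fun x hx => ?_
  rw [abs_of_pos (inv_pos.2 (qsEps_pos hx))]
  unfold qsEps qsC
  rw [show (minGap x / (4 * (2 * ‖x‖ + 1)) / 4)⁻¹ = 16 * (‖x‖ * 2 + 1) * (minGap x)⁻¹ by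
    field_simp; ring]

/-- The dual bound. [folklore] -/
theorem polyDom_qsDd : PolyDom k d fun x => qsDd (k := k) x := by
  refine ((const (2 * (1 + Real.sqrt d))).mul polyDom_inv_qsEps).of_abs_le fun x hx => ?_
  rw [abs_of_nonneg (qsDd_nonneg hx)]
  unfold qsDd
  rw [div_eq_mul_inv]

/-- `r₀⁻¹ ≤ 1 + 16 / minGap`. [folklore] -/
theorem polyDom_inv_qsR0 : PolyDom k d fun x => (qsR0 x)⁻¹ := by
  refine ((const 1).add ((const 16).mul inv_minGap)).inv_of_le fun x hx => ⟨qsR0_pos hx, ?_⟩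
  have hγ := minGap_pos hx
  unfold qsR0 qsG
  rcases le_total 1 (minGap x / 4 / 4) with h | h
  · rw [min_eq_left h, inv_one]
    have : 0 ≤ 16 * (minGap x)⁻¹ := by positivity
    linarith
  · rw [min_eq_right h]
    rw [show (minGap x / 4 / 4)⁻¹ = 16 * (minGap x)⁻¹ by field_simp; ring]
    linarith

/-- `r₀` itself (`≤ 1`). [folklore] -/
theorem polyDom_qsR0 : PolyDom k d fun x => qsR0 (k := k) x :=
  (const 1).of_abs_le fun x hx => by rw [abs_of_pos (qsR0_pos hx)]; exact qsR0_le_one x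

/-- The multiplier constant. [folklore] -/
theorem polyDom_qsD (M : ℕ) : PolyDom k d fun x => qsD (k := k) M x :=
  (const 1).max ((const (2 ^ M)).mul (polyDom_qsDd.mul (polyDom_qsR0.add (const 1))))

/-- The upper Jacobian bound. [folklore] -/
theorem polyDom_qsCUp : PolyDom k d fun x => qsCUp (k := k) x :=
  (((const (2 * Real.sqrt ((k + 2 : ℝ) * d))).mul polyDom_qsDd).pow _).mul (const _)

/-- The scalar bound. [folklore] -/
theorem polyDom_qsA0B : PolyDom k d fun x => qsA0B (k := k) x := by
  have hv1 : 0 < (volume (Metric.ball (0 : EuclideanSpace ℝ (Fin d)) 1)).toReal :=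
    ENNReal.toReal_pos (Metric.measure_ball_pos volume _ one_pos).ne' measure_ball_lt_top.ne
  have hvol : ∀ x ∈ orderedRegion k d, (volume (Metric.closedBall (0 : EuclideanSpace ℝ (Fin d)) (qsR0 x / 2))).toReal =
      (qsR0 x / 2) ^ d * (volume (Metric.ball (0 : EuclideanSpace ℝ (Fin d)) 1)).toReal := fun x hx => by
    rw [Measure.addHaar_closedBall volume _ (by have := qsR0_pos hx; positivity), finrank_euclideanSpace_fin,
      ENNReal.toReal_mul, ENNReal.toReal_ofReal (by have := qsR0_pos hx; positivity)]
  refine ((const ((qsCLow k d)⁻¹ * ((volume (Metric.ball (0 : EuclideanSpace ℝ (Fin d)) 1)).toReal ^ (k + 2))⁻¹)).mul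
    (((const 2).mul polyDom_inv_qsR0).pow (d * (k + 2)))).of_abs_le fun x hx => ?_
  have hr := qsR0_pos hx
  have hc := qsCLow_pos (d := d) k
  unfold qsA0B
  rw [hvol x hx, abs_of_pos (inv_pos.2 (mul_pos hc (pow_pos (mul_pos (pow_pos (by positivity) _) hv1) _)))]
  refine le_of_eq ?_
  rw [mul_pow, ← pow_mul, mul_inv, mul_inv, mul_pow, ← inv_pow, show (qsR0 x / 2)⁻¹ = 2 * (qsR0 x)⁻¹ by
    rw [inv_div, div_eq_mul_inv]]
  ring

/-- The profile bound. [folklore] -/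
theorem polyDom_qsPB (M : ℕ) : PolyDom k d fun x => qsPB (k := k) M x :=
  (((polyDom_inv_qsR0.pow M).mul (const _)).pow _).of_abs_le fun x hx => by
    unfold qsPB
    have := QuantumLattice.schwartzNorm_nonneg M (rawBumpS (V := EuclideanSpace ℝ (Fin d)) one_pos)
    rw [inv_pow, abs_of_nonneg (by have := qsR0_pos hx; positivity)]

/-- `t⁻¹ = 8 (d + 1) / minGap`. [folklore] -/
theorem polyDom_inv_qsT : PolyDom k d fun x => (qsT x)⁻¹ :=
  ((const (8 * ((d : ℝ) + 1))).mul inv_minGap).of_abs_le fun x hx => by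
    rw [abs_of_pos (inv_pos.2 (qsT_pos hx))]
    unfold qsT
    rw [inv_div, div_eq_mul_inv]

/-- `t ≤ minGap`. [folklore] -/
theorem polyDom_qsT : PolyDom k d fun x => qsT (k := k) x :=
  minGap'.of_abs_le fun x hx => by
    rw [abs_of_pos (qsT_pos hx)]
    unfold qsT
    rw [div_le_iff₀ (by positivity)]
    have := minGap_pos hx
    have : (1 : ℝ) ≤ 8 * (d + 1) := by have : (0 : ℝ) ≤ d := Nat.cast_nonneg d; linarith
    nlinarith

/-- `r⁻¹ = t⁻¹ / sin α`. [folklore] -/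
theorem polyDom_inv_qsR : PolyDom k d fun x => (qsR x)⁻¹ :=
  (polyDom_inv_qsT.mul (const (Real.sin (π / (4 * (slotK k d + 1))))⁻¹)).of_abs_le fun x hx => by
    rw [abs_of_pos (inv_pos.2 (qsR_pos hx))]
    unfold qsR
    rw [mul_inv]

/-! ### The transcendental piece: `e^Λ` -/

/-- **`e^Λ` is polynomially dominated**: `e^Λ ≤ ((t−r) + (t−r)⁻¹)((t+r) + (t+r)⁻¹)` with
`t ± r = t (1 ± sin α)`. [folklore] -/
theorem polyDom_exp_qsLam : PolyDom k d fun x => Real.exp (qsLam x) := by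
  set σ : ℝ := Real.sin (π / (4 * (slotK k d + 1))) with hσ
  have hσ0 : 0 < σ := (sin_angle_pos_lt_one _).1
  have hσ1 : σ < 1 := (sin_angle_pos_lt_one _).2
  have hsub : ∀ x : Fin (k + 2) → EuclideanSpace ℝ (Fin d), qsT x - qsR x = qsT x * (1 - σ) := fun x => by
    unfold qsR; rw [← hσ]; ring
  have hadd : ∀ x : Fin (k + 2) → EuclideanSpace ℝ (Fin d), qsT x + qsR x = qsT x * (1 + σ) := fun x => by
    unfold qsR; rw [← hσ]; ring
  have hσ' : 0 < 1 - σ := by linarith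
  have h1 : PolyDom k d fun x => (qsT x * (1 - σ) + (qsT x * (1 - σ))⁻¹) :=
    (polyDom_qsT.mul (const _)).add ((polyDom_inv_qsT.mul (const (1 - σ)⁻¹)).of_abs_le fun x hx => by
      rw [mul_inv, abs_of_pos (mul_pos (inv_pos.2 (qsT_pos hx)) (inv_pos.2 hσ'))])
  have h2 : PolyDom k d fun x => (qsT x * (1 + σ) + (qsT x * (1 + σ))⁻¹) :=
    (polyDom_qsT.mul (const _)).add ((polyDom_inv_qsT.mul (const (1 + σ)⁻¹)).of_abs_le fun x hx => by
      rw [mul_inv, abs_of_pos (mul_pos (inv_pos.2 (qsT_pos hx)) (inv_pos.2 (by linarith)))])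
  refine (h1.mul h2).of_abs_le fun x hx => ?_
  have ht := qsT_pos hx
  have hm : 0 < qsT x * (1 - σ) := mul_pos ht hσ'
  have hp : 0 < qsT x * (1 + σ) := mul_pos ht (by linarith)
  rw [abs_of_pos (Real.exp_pos _), qsLam, Real.exp_add, hsub, hadd]
  exact mul_le_mul (exp_abs_log_le hm) (exp_abs_log_le hp) (Real.exp_pos _).le (add_pos hm (inv_pos.2 hm)).le

/-- `e^{1+Λ}`. [folklore] -/
theorem polyDom_exp_one_add_qsLam : PolyDom k d fun x => Real.exp (1 + qsLam x) :=
  ((const (Real.exp 1)).mul polyDom_exp_qsLam).of_abs_le fun x _ => by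
    rw [abs_of_pos (Real.exp_pos _), Real.exp_add]

/-- `1 + Λ ≤ e^{1+Λ}`… in fact `1 + Λ ≤ e^Λ`. [folklore] -/
theorem polyDom_one_add_qsLam : PolyDom k d fun x => 1 + qsLam x :=
  polyDom_exp_qsLam.of_abs_le fun x _ => by
    rw [abs_of_nonneg (by linarith [qsLam_nonneg x])]
    linarith [Real.add_one_le_exp (qsLam x)]

/-! ### The three factors of `qsA` -/

/-- **The sector factor**: `qsE ≤ e^{2(K+1)(1+Λ)}`. [folklore] -/
theorem polyDom_qsE : PolyDom k d fun x => qsE (k := k) x := by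
  refine ((polyDom_exp_one_add_qsLam).pow (2 * (slotK k d + 1))).of_abs_le fun x _ => ?_
  rw [abs_of_pos (by unfold qsE; exact Real.exp_pos _)]
  unfold qsE
  rw [← Real.exp_nat_mul, Real.exp_le_exp]
  have hΛ := qsLam_nonneg x
  have hb : |qsB x| = (1 + qsLam x)⁻¹ := by rw [qsB, abs_of_pos (by positivity)]
  rw [hb]
  have hL : 0 < 1 + qsLam x := by linarith
  have h1 : (qsLam x + π / 4) ^ 2 ≤ (1 + qsLam x) ^ 2 := by
    have : π / 4 ≤ 1 := by linarith [Real.pi_le_four]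
    exact pow_le_pow_left₀ (by positivity) (by linarith) 2
  have h2 : 2 * (1 + qsLam x)⁻¹ * (slotK k d + 1) * (qsLam x + π / 4) ^ 2 ≤
      2 * (1 + qsLam x)⁻¹ * (slotK k d + 1) * (1 + qsLam x) ^ 2 := by gcongr
  refine h2.trans (le_of_eq ?_)
  rw [sq, show 2 * (1 + qsLam x)⁻¹ * (slotK k d + 1 : ℝ) * ((1 + qsLam x) * (1 + qsLam x)) =
    2 * (slotK k d + 1 : ℝ) * (1 + qsLam x) * ((1 + qsLam x)⁻¹ * (1 + qsLam x)) by ring, inv_mul_cancel₀ hL.ne', mul_one]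
  push_cast
  ring

/-- Each slot constant is dominated (through `slotPosConst ≤ 2(k+1)(2‖x‖ + minGap/8) + minGap/8 + 1 + 2(k+1)d`). [folklore] -/
theorem polyDom_unitSlotC {Cv : ℕ → ℝ} (hCv : ∀ n, 0 ≤ Cv n) (M : ℕ) (j : Fin (slotK k d + 1)) :
    PolyDom k d fun x => unitSlotC (qsXi x) (qsFrame x) (qsG x) Cv M j := by
  have hpos : PolyDom k d fun x => slotPosConst (k := k) (qsXi x) (qsFrame x) (qsG x) := by
    refine ((((const (2 * ((k : ℝ) + 1))).mul ((norm.mul (const 2)).add (minGap'.mul (const (1 / 8))))).add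
      ((minGap'.mul (const (1 / 8))).add ((const 1).add (const (2 * (((k : ℝ) + 1) * d)))))).of_abs_le fun x hx => ?_)
    have h0 : 0 ≤ slotPosConst (k := k) (qsXi x) (qsFrame x) (qsG x) := zero_le_one.trans (one_le_slotPosConst _ _ _)
    rw [abs_of_nonneg h0]
    unfold slotPosConst
    rw [sum_norm_qsFrame hx, qsG, abs_of_pos (by have := minGap_pos hx; positivity)]
    have h1 := norm_qsXi_le hx
    have hk : (0 : ℝ) ≤ k + 1 := by positivity
    nlinarith
  refine ((const (Cv (nL (slotEquiv k d j).1) * Cv (nR (slotEquiv k d j).1) *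
    ((2 ^ (M + 1)) ^ 2 * (2 ^ (M + 1)) ^ (k + 2)))).mul (hpos.pow (M + M))).of_abs_le fun x _ => ?_
  rw [abs_of_nonneg (unitSlotC_nonneg _ _ hCv M j)]
  unfold unitSlotC
  exact le_of_eq (by ring)

/-- **The slot factor** (through `slotBmax_le` and `logWindowConst b N ≤ 2ᴺ · 2 e^{(N+1)²(1+Λ)}`). [folklore] -/
theorem polyDom_qsU {Cv : ℕ → ℝ} (hCv : ∀ n, 0 ≤ Cv n) (M : ℕ) : PolyDom k d fun x => qsU (k := k) Cv M x := by
  -- the maximal slot constant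
  have hCmax : PolyDom k d fun x => ∑ j : Fin (slotK k d + 1), unitSlotC (qsXi x) (qsFrame x) (qsG x) Cv M j :=
    PolyDom.sum _ fun j _ => polyDom_unitSlotC hCv M j
  -- the window constant
  have hW : PolyDom k d fun x => logWindowConst (qsB x) (M + M) := by
    have hN : PolyDom k d fun x => Real.exp (1 + qsLam x) ^ (M + M + 1) ^ 2 := polyDom_exp_one_add_qsLam.pow _
    refine (((const (2 ^ (M + M))).mul (polyDom_exp_one_add_qsLam.add hN))).of_abs_le fun x _ => ?_
    rw [abs_of_pos (logWindowConst_pos _ _)]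
    unfold logWindowConst
    have hΛ := qsLam_nonneg x
    have hb : (qsB x)⁻¹ = 1 + qsLam x := by rw [qsB, inv_inv]
    have e1 : Real.exp (1 / (4 * qsB x)) ≤ Real.exp (1 + qsLam x) := by
      rw [Real.exp_le_exp, show 1 / (4 * qsB x) = (1 + qsLam x) / 4 by rw [← hb]; field_simp]
      linarith
    have e2 : Real.exp (((M + M : ℕ) + 1 : ℝ) ^ 2 / (4 * qsB x)) ≤ Real.exp (1 + qsLam x) ^ (M + M + 1) ^ 2 := by
      rw [← Real.exp_nat_mul, Real.exp_le_exp,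
        show ((M + M : ℕ) + 1 : ℝ) ^ 2 / (4 * qsB x) = ((M + M : ℕ) + 1 : ℝ) ^ 2 * (1 + qsLam x) / 4 by rw [← hb]; field_simp]
      push_cast
      nlinarith [sq_nonneg ((M : ℝ) + M + 1)]
    push_cast at e2 ⊢
    gcongr
  refine (hCmax.mul (hW.pow (slotK k d))).of_abs_le fun x hx => ?_
  have hU0 : 0 ≤ qsU (k := k) Cv M x := unitSlotBmaxW_nonneg _ _ _ hCv M
  rw [abs_of_nonneg hU0]
  unfold qsU unitSlotBmaxW
  refine LogSlot.slotBmax_le (qsB_pos x) (unitSlotC_nonneg _ _ hCv M) (fun i => ?_) (M + M)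
  exact Finset.single_le_sum (f := fun j => unitSlotC (qsXi x) (qsFrame x) (qsG x) Cv M j)
    (fun j _ => unitSlotC_nonneg _ _ hCv M j) (Finset.mem_univ i)

/-- **The tube factor**: `qsTT = e^{2b(3π/8)²} √(π(1+Λ)/2) · tubeTail ≤ const · (1 + Λ)`. [folklore] -/
theorem polyDom_qsTT : PolyDom k d fun x => qsTT k d x := by
  have hT0 : 0 ≤ tubeTail (slotK k d) (π / 4) := integral_nonneg fun p => (Real.exp_pos _).le
  refine (((const (Real.exp (2 * (max ((π / 4 + π / 2) / 2) 0) ^ 2))).mul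
    ((const 1).add ((const (π / 2)).mul polyDom_one_add_qsLam))).mul (const (tubeTail (slotK k d) (π / 4)))).of_abs_le
    fun x _ => ?_
  have hq : qsTT k d x = Real.exp (2 * qsB x * (max ((π / 4 + π / 2) / 2) 0) ^ 2) * Real.sqrt (π / (2 * qsB x)) *
      tubeTail (slotK k d) (π / 4) := by
    unfold qsTT unitTubeConstW
    exact l1TubeBound_unit_eq (qsB x) (slotK k d) (π / 4)
  rw [hq, abs_of_nonneg (mul_nonneg (mul_nonneg (Real.exp_pos _).le (Real.sqrt_nonneg _)) hT0)]
  have hb0 := qsB_pos x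
  have hb1 := qsB_le_one x
  have h1 : Real.exp (2 * qsB x * (max ((π / 4 + π / 2) / 2) 0) ^ 2) ≤ Real.exp (2 * (max ((π / 4 + π / 2) / 2) 0) ^ 2) := by
    rw [Real.exp_le_exp]; nlinarith [sq_nonneg (max ((π / 4 + π / 2) / 2) 0)]
  have hΛ := qsLam_nonneg x
  have h2 : Real.sqrt (π / (2 * qsB x)) ≤ 1 + π / 2 * (1 + qsLam x) := by
    have hy : π / (2 * qsB x) = π / 2 * (1 + qsLam x) := by rw [qsB]; field_simp
    rw [hy]
    exact Real.sqrt_le_iff.2 ⟨by positivity, by nlinarith [Real.pi_pos, qsLam_nonneg x, sq_nonneg (π / 2 * (1 + qsLam x))]⟩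
  gcongr

/-- **The `a`-independent factor is dominated.** [folklore] -/
theorem polyDom_qsA {Cv : ℕ → ℝ} (hCv : ∀ n, 0 ≤ Cv n) (M : ℕ) : PolyDom k d fun x => qsA (k := k) Cv M x :=
  (polyDom_qsE.mul (polyDom_qsU hCv M)).mul polyDom_qsTT

/-! ### The explicit bound is dominated -/

/-- **`qsF` is polynomially dominated in `1 + ‖x‖` and `1 + (minGap x)⁻¹`.** [folklore] -/
theorem polyDom_qsF {Cv : ℕ → ℝ} (hCv : ∀ n, 0 ≤ Cv n) (M : ℕ) : PolyDom k d fun x => qsF (k := k) Cv M x := by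
  set p : ℕ := (d + M) * (k + 2) with hp
  have hq : PolyDom k d fun x => (2 * ((p : ℝ) + 2) / qsR x) := ((const _).mul polyDom_inv_qsR).of_abs_le fun x hx => by
    rw [div_eq_mul_inv, abs_of_pos (by have := qsR_pos hx; positivity)]
  have hterm : ∀ n : ℕ, PolyDom k d fun x =>
      ((k + 2 : ℝ) * d) ^ n * 2 ^ n * qsD M x ^ n * (2 * (p + 2) / qsR x) ^ n / (n.factorial : ℝ) := fun n =>
    (((((const ((((k : ℝ) + 2) * d) ^ n)).mul (const ((2 : ℝ) ^ n))).mul ((polyDom_qsD M).pow n)).mul (hq.pow n)).mul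
      (const ((n.factorial : ℝ)⁻¹))).congr fun x _ => by rw [div_eq_mul_inv]
  have hlast : PolyDom k d fun x =>
      ((k + 2 : ℝ) * d) ^ (p + 1) * 2 ^ (p + 1) * qsD M x ^ (p + 1) * (2 * (p + 2) / qsR x) ^ (p + 1) / (p.factorial : ℝ) :=
    (((((const ((((k : ℝ) + 2) * d) ^ (p + 1))).mul (const ((2 : ℝ) ^ (p + 1)))).mul ((polyDom_qsD M).pow (p + 1))).mul
      (hq.pow (p + 1))).mul (const ((p.factorial : ℝ)⁻¹))).congr fun x _ => by rw [div_eq_mul_inv]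
  have hS : PolyDom k d fun x => ∑ n ∈ Finset.range (p + 1),
      ((k + 2 : ℝ) * d) ^ n * 2 ^ n * qsD M x ^ n * (2 * (p + 2) / qsR x) ^ n / (n.factorial : ℝ) +
      ((k + 2 : ℝ) * d) ^ (p + 1) * 2 ^ (p + 1) * qsD M x ^ (p + 1) * (2 * (p + 2) / qsR x) ^ (p + 1) / (p.factorial : ℝ) :=
    (PolyDom.sum _ fun n _ => hterm n).add hlast
  refine (polyDom_qsCUp.mul ((((polyDom_qsA hCv M).mul polyDom_qsA0B).mul (polyDom_qsPB M)).mul hS)).congr fun x _ => ?_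
  unfold qsF descBound
  rw [← hp]

end Literature.MathematicalPhysics.QuantumFieldTheory
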